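import Literature.Barriers.ABC.BakerMethodBoundsStewartYuProofs
import Literature.NumberTheory.DiophantineGeometry.AbcWave0QualityFormProofs
import HarnessLib

/-!
# Route PlacewiseSzpiro, crux `SingleTowerSzpiro` (stmt-ABC-22410), line `birth`:
# what the Baker method gives AT ONE PLACE of an abc triple (the Frey locus of the crux)

Summits-side helper (theorems only; no definition, no named fact, no `Theses` import). It serves the critic's
«first deliverable» (`stub_firstDeliverable_towerBelowStewartYu`: a single-tower bound below the Stewart–Yu scale)
on the one locus where the benchmark «`log|Δ_min| ≤` Stewart–Yu» is a theorem: Frey–Hellegouarch curves of abc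
triples, whose tower at an odd prime `p` is `2 ν_p(abc) · log p` (`IsABCTriple.factorization_minimalDiscriminantNorm_freyCurve`).

`Literature.Barriers.ABC.BakerMethodBounds = BakerShapeBound (1/3) 3` (Stewart–Yu 2001 Thm 1, `log c ≤ κ R^{1/3}(log R)³`)
is PROVED in the tree from `PastenApproximationBound K` (Pasten 2024 Thm 2.1 ⇐ Evertse–Győry Thm 4.2.1 over `ℚ`,
Matveev + Yu 2007) by combining three PLACE BOUNDS: at `p ∣ w ∈ {a, b, c}`,
`ν_p(w) · log p < Θ_{uv} · (p / log p)(log p + Y)`, `Θ_{uv} = K^{ω(uv)+1} ∏_{q ∣ uv} log q`, `Y = log max{e, 2 log c}`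
(`Pasten.padic_bound_a/_c`; "the `p`-adic orders of `A, B, C` with `p` running through the small primes",
`BakerMethodBoundsThreeRoutesProofs`). Read ON ITS OWN, that per-prime step says:

* `exists_prod_mul_log_div_rpow_le`: `∏_{p ∈ S} A log p / p^η ≤ C(A, η)` over finite sets of primes; hence
  `theta_zero_le_mul_rpow`: `Θ_{uv} ≤ K · C · rad(abc)^η` for `uv ∣ abc` — Pasten's `Θ` at threshold `0` is
  SUB-POLYNOMIAL in the radical; and `log_max_two_mul_log_le_mul_rpow`: `Y ≤ C'(η) R^η` (via Stewart–Yu itself);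
* **`exists_single_place_bound_of_approximationBound`: `ν_p(abc) · log p ≤ C(η) · p · rad(abc)^η`** for every
  `η > 0`, every abc triple and every prime `p ∣ abc` (conditional on `PastenApproximationBound K`, for which
  the tree's one named fact `evertseGyory_thm_4_2_1_rat` suffices: `pasten2024_thm_2_1`, `one_le_pastenK`);
* **`exists_single_place_bound_below_stewartYu_of_approximationBound`**: for every `δ > 0`,
  `ν_p(abc) · log p ≤ C · rad(abc)^{1/3 − δ}` at every prime `p ∣ abc` with `p ≤ rad(abc)^{1/3 − 2δ}` — at the SMALL
  primes one tower is strictly BELOW the Stewart–Yu scale of the whole `log c`; at a FIXED prime it is `≪_η R^η`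
  (the crux asks `≤ (6+ε) log N_E + C`).

What this is NOT. No new bound for `log c` (at `p > R^{1/3}` the factor `p` loses to the trivial
`ν_p(c) log p ≤ log c`; the exponent `1/3` of the sum is untouched). Nothing for a general `E/ℚ`, which carries no
`S`-unit equation over `ℚ`. Conditional on `PastenApproximationBound K` (≡ the trust base of `BakerMethodBounds`).
No summit, rung or stub is proved; A1′/A-PS are NOT abc; conditional ≠ proved.

References: [StewartYu2001] Duke 108 (2001), Thm 1 + proof; [Pasten2024] Invent. 236 (2024), Thm 2.1, §5.
-/

noncomputable section

open Finset Real Height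
open Literature.NumberTheory.DiophantineGeometry
open Literature.NumberTheory.DiophantineGeometry.Dioph
open Literature.NumberTheory.DiophantineGeometry.Pasten

-- `Summit.<Summit>.<Problem>` is the mandated summit-side namespace (CONVENTIONS §2); for the
-- single-conjunct summit `ABC` the two coincide, so the duplicate `ABC.ABC` is deliberate.
set_option linter.dupNamespace false

namespace Summit.ABC.ABC.Theorems.SingleTowerSzpiroLine

open Literature.Barriers.ABC

/-! ### Primes beat `A log p / p^η` -/

/-- For `A ≥ 0`, `η > 0`, `p ≥ 1` and `p^{η/2} ≥ 2A/η`: `A · log p ≤ p^η`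
(via `log p ≤ (2/η) p^{η/2}`). [folklore] -/
theorem mul_log_le_rpow {A η p : ℝ} (hA : 0 ≤ A) (hη : 0 < η) (hp1 : 1 ≤ p)
    (hp : 2 * A / η ≤ p ^ (η / 2)) : A * Real.log p ≤ p ^ η := by
  have hp0 : 0 ≤ p := zero_le_one.trans hp1
  have hη2 : 0 < η / 2 := half_pos hη
  have hlog0 : 0 ≤ Real.log p := Real.log_nonneg hp1
  have h1 : Real.log p ≤ p ^ (η / 2) / (η / 2) := Real.log_le_rpow_div hp0 hη2
  have hpow0 : 0 ≤ p ^ (η / 2) := Real.rpow_nonneg hp0 _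
  have h2 : A * Real.log p ≤ (2 * A / η) * p ^ (η / 2) := by
    calc A * Real.log p ≤ A * (p ^ (η / 2) / (η / 2)) := mul_le_mul_of_nonneg_left h1 hA
      _ = (2 * A / η) * p ^ (η / 2) := by field_simp
  calc A * Real.log p ≤ (2 * A / η) * p ^ (η / 2) := h2
    _ ≤ p ^ (η / 2) * p ^ (η / 2) := mul_le_mul_of_nonneg_right hp hpow0
    _ = p ^ η := by rw [← Real.rpow_add_of_nonneg hp0 hη2.le hη2.le]; ring_nf

/-- **Primes beat `A log p / p^η`.** For `A ≥ 0` and `η > 0` there is `C ≥ 1` with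
`∏_{p ∈ S} A · log p / p^η ≤ C` for every finite set `S` of primes: beyond the threshold
`p₀ = (2A/η)^{2/η}` each factor is `≤ 1` (`mul_log_le_rpow`), below it there are finitely many primes.
(The analogue of `exists_prod_mul_log_sq_div_le`.) [folklore] -/
theorem exists_prod_mul_log_div_rpow_le {A η : ℝ} (hA : 0 ≤ A) (hη : 0 < η) :
    ∃ C : ℝ, 1 ≤ C ∧ ∀ S : Finset ℕ, (∀ p ∈ S, p.Prime) →
      ∏ p ∈ S, A * Real.log p / (p : ℝ) ^ η ≤ C := by
  classical
  set N : ℕ := ⌈(2 * A / η) ^ (2 / η)⌉₊ + 1 with hN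
  set f : ℕ → ℝ := fun p => A * Real.log p / (p : ℝ) ^ η with hf
  set C : ℝ := ∏ p ∈ (Finset.range N).filter Nat.Prime, max 1 (f p) with hC
  have hC1 : 1 ≤ C := Finset.one_le_prod fun p _ => le_max_left _ _
  refine ⟨C, hC1, fun S hS => ?_⟩
  have hf0 : ∀ p ∈ S, 0 ≤ f p := fun p hp => by
    have h1 : (1 : ℝ) ≤ p := by exact_mod_cast (hS p hp).one_lt.le
    have := Real.log_nonneg h1
    positivity
  rw [← Finset.prod_filter_mul_prod_filter_not S (fun p => p < N)]
  have hsmall : ∏ p ∈ S.filter (fun p => p < N), f p ≤ C := by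
    calc ∏ p ∈ S.filter (fun p => p < N), f p
        ≤ ∏ p ∈ S.filter (fun p => p < N), max 1 (f p) :=
          Finset.prod_le_prod (fun p hp => hf0 p (Finset.mem_filter.mp hp).1)
            fun p _ => le_max_right _ _
      _ ≤ C := by
          apply Finset.prod_le_prod_of_subset_of_one_le
          · intro p hp
            obtain ⟨hpS, hpN⟩ := Finset.mem_filter.mp hp
            exact Finset.mem_filter.mpr ⟨Finset.mem_range.mpr hpN, hS p hpS⟩
          · intro p _; exact zero_le_one.trans (le_max_left _ _)
          · intro p _ _; exact le_max_left _ _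
  have hlarge : ∏ p ∈ S.filter (fun p => ¬p < N), f p ≤ 1 := by
    refine Finset.prod_le_one (fun p hp => hf0 p (Finset.mem_filter.mp hp).1) fun p hp => ?_
    obtain ⟨hpS, hpN⟩ := Finset.mem_filter.mp hp
    have hp1 : (1 : ℝ) ≤ p := by exact_mod_cast (hS p hpS).one_lt.le
    have hp0 : (0 : ℝ) ≤ p := zero_le_one.trans hp1
    have hpN' : (2 * A / η) ^ (2 / η) ≤ (p : ℝ) := by
      have h1 : ((⌈(2 * A / η) ^ (2 / η)⌉₊ : ℕ) : ℝ) ≤ (p : ℝ) := by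
        exact_mod_cast (show ⌈(2 * A / η) ^ (2 / η)⌉₊ ≤ p by omega)
      exact (Nat.le_ceil _).trans h1
    -- `p^{η/2} ≥ 2A/η`
    have hkey : 2 * A / η ≤ (p : ℝ) ^ (η / 2) := by
      have hB : 0 ≤ 2 * A / η := by positivity
      have h2 : ((2 * A / η) ^ (2 / η)) ^ (η / 2) ≤ (p : ℝ) ^ (η / 2) :=
        Real.rpow_le_rpow (Real.rpow_nonneg hB _) hpN' (half_pos hη).le
      have h3 : ((2 * A / η) ^ (2 / η)) ^ (η / 2) = 2 * A / η := by
        rw [← Real.rpow_mul hB]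
        have : (2 / η) * (η / 2) = 1 := by field_simp
        rw [this, Real.rpow_one]
      rwa [h3] at h2
    have key := mul_log_le_rpow hA hη hp1 hkey
    rw [hf]; dsimp only
    rw [div_le_one (Real.rpow_pos_of_pos (by linarith) η)]
    exact key
  have h0 : 0 ≤ ∏ p ∈ S.filter (fun p => ¬p < N), f p :=
    Finset.prod_nonneg fun p hp => hf0 p (Finset.mem_filter.mp hp).1
  calc (∏ p ∈ S.filter (fun p => p < N), f p) * ∏ p ∈ S.filter (fun p => ¬p < N), f p
      ≤ C * 1 := mul_le_mul hsmall hlarge h0 (zero_le_one.trans hC1)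
    _ = C := mul_one C

/-! ### Pasten's `Θ` at threshold `0` is sub-polynomial in the radical -/

/-- `∏_{q ∣ n} q^η ≤ rad(abc)^η` for `n ∣ abc`, `abc ≠ 0` (`η ≥ 0`): the primes of `n` are among those of
`abc` and `∏_{q ∣ abc} q = rad(abc)`. [folklore] -/
theorem prod_primeFactors_rpow_le_rad_rpow {n a b c : ℕ} (hn : n ∣ a * b * c) (h0 : a * b * c ≠ 0)
    {η : ℝ} (hη : 0 ≤ η) :
    ∏ q ∈ n.primeFactors, (q : ℝ) ^ η ≤ (rad a b c : ℝ) ^ η := by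
  have hsub : n.primeFactors ⊆ (a * b * c).primeFactors := Nat.primeFactors_mono hn h0
  have hrad : (rad a b c : ℝ) = ∏ q ∈ (a * b * c).primeFactors, (q : ℝ) := by
    rw [rad_def, Nat.radical_eq_prod_primeFactors]; push_cast; rfl
  rw [hrad, ← Real.finsetProd_rpow _ _ (fun q _ => by positivity),
    ← Finset.prod_sdiff hsub]
  have h1 : (1 : ℝ) ≤ ∏ q ∈ (a * b * c).primeFactors \ n.primeFactors, (q : ℝ) ^ η :=
    Finset.one_le_prod fun q hq =>
      Real.one_le_rpow (by exact_mod_cast (Nat.prime_of_mem_primeFactors (Finset.sdiff_subset hq)).one_lt.le) hη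
  have h0' : 0 ≤ ∏ q ∈ n.primeFactors, (q : ℝ) ^ η :=
    Finset.prod_nonneg fun q _ => Real.rpow_nonneg (by positivity) _
  exact le_mul_of_one_le_left h0' h1

/-- **`Θ_{uv} ≤ K · C · rad(abc)^η`** for coprime non-zero `u, v` with `uv ∣ abc` (`abc ≠ 0`), where `C = C(K, η)`
bounds the products `∏ K log q / q^η` over finite sets of primes:
`Θ_{uv} = K^{ω(uv)+1} ∏_{q ∣ uv} log q = K · ∏_{q ∣ uv} (K log q / q^η) · ∏_{q ∣ uv} q^η`. So Pasten's `Θ` at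
threshold `0` — the product of the heights of the generators "the primes of `uv`" — is sub-polynomial in the
radical. [folklore] -/
theorem theta_zero_le_mul_rpow {K C η : ℝ} (hK : 1 ≤ K) (hη : 0 ≤ η)
    (hC : ∀ S : Finset ℕ, (∀ p ∈ S, p.Prime) → ∏ p ∈ S, K * Real.log p / (p : ℝ) ^ η ≤ C)
    {u v a b c : ℕ} (hu : u ≠ 0) (hv : v ≠ 0) (huv : u.Coprime v) (hdvd : u * v ∣ a * b * c)
    (h0 : a * b * c ≠ 0) :
    theta K u v 0 ≤ K * C * (rad a b c : ℝ) ^ η := by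
  have hK0 : 0 ≤ K := zero_le_one.trans hK
  rw [theta_zero_eq K hu hv huv]
  set S := (u * v).primeFactors with hS
  have hSp : ∀ p ∈ S, p.Prime := fun p hp => Nat.prime_of_mem_primeFactors hp
  have hpos : ∀ p ∈ S, 0 < (p : ℝ) ^ η := fun p hp =>
    Real.rpow_pos_of_pos (by exact_mod_cast (hSp p hp).pos) η
  -- `K^{|S|+1} ∏ log q = K · ∏ (K log q / q^η) · ∏ q^η`
  have hsplit : K ^ (S.card + 1) * ∏ p ∈ S, Real.log (p : ℝ) =
      K * ((∏ p ∈ S, K * Real.log p / (p : ℝ) ^ η) * ∏ p ∈ S, (p : ℝ) ^ η) := by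
    rw [← Finset.prod_mul_distrib]
    have : ∀ p ∈ S, K * Real.log p / (p : ℝ) ^ η * (p : ℝ) ^ η = K * Real.log p := fun p hp =>
      div_mul_cancel₀ _ (hpos p hp).ne'
    rw [Finset.prod_congr rfl this, Finset.prod_mul_distrib, Finset.prod_const, pow_succ]
    ring
  rw [hsplit, mul_assoc]
  refine mul_le_mul_of_nonneg_left ?_ hK0
  have hlog0 : ∀ p ∈ S, 0 ≤ K * Real.log p / (p : ℝ) ^ η := fun p hp => by
    have := Real.log_nonneg (show (1 : ℝ) ≤ p by exact_mod_cast (hSp p hp).one_lt.le)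
    have := hpos p hp
    positivity
  have h1 : ∏ p ∈ S, K * Real.log p / (p : ℝ) ^ η ≤ C := hC S hSp
  have h2 : ∏ p ∈ S, (p : ℝ) ^ η ≤ (rad a b c : ℝ) ^ η := prod_primeFactors_rpow_le_rad_rpow hdvd h0 hη
  have hC0 : 0 ≤ C := (Finset.prod_nonneg hlog0).trans h1
  exact mul_le_mul h1 h2 (Finset.prod_nonneg fun p hp => (hpos p hp).le) hC0

/-! ### `Y = log max{e, 2 log c}` is sub-polynomial in the radical (via Stewart–Yu) -/

/-- From a Baker-shape bound `log c ≤ κ R^{1/3} (log R)³` (Stewart–Yu 2001): for every `η > 0`,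
`log max{e, 2 log c} ≤ (log(2|κ| + 3) + 8/η) · R^η` for every abc triple
(`R^{1/3}(log R)³ ≤ R⁴`, `log R ≤ (2/η) R^{η/2} ≤ (2/η) R^η`, `R ≥ 2`). [folklore] -/
theorem log_max_two_mul_log_le_mul_rpow (hB : BakerShapeBound (1 / 3) 3) {η : ℝ} (hη : 0 < η) :
    ∃ C : ℝ, 1 ≤ C ∧ ∀ a b c : ℕ, IsABCTriple a b c →
      Real.log (max (Real.exp 1) (2 * Real.log c)) ≤ C * (rad a b c : ℝ) ^ η := by
  obtain ⟨κ, hκ⟩ := hB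
  have hlk : 0 ≤ Real.log (2 * |κ| + 3) := Real.log_nonneg (by linarith [abs_nonneg κ])
  refine ⟨Real.log (2 * |κ| + 3) + 8 / η, ?_, fun a b c ht => ?_⟩
  · -- `1 ≤ log(2|κ|+3) + 8/η`: `log 3 ≥ 1` already
    have h3 : (1 : ℝ) ≤ Real.log (2 * |κ| + 3) := by
      rw [← Real.log_exp 1]
      refine Real.log_le_log (Real.exp_pos 1) ?_
      have := Real.exp_one_lt_d9
      linarith [abs_nonneg κ]
    have : 0 ≤ 8 / η := by positivity
    linarith
  have h1 := hκ a b c ht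
  have hR2 : (2 : ℝ) ≤ (rad a b c : ℝ) := by exact_mod_cast IsABCTriple.two_le_rad ht
  set R : ℝ := (rad a b c : ℝ) with hRdef
  have hR1 : (1 : ℝ) ≤ R := by linarith
  have hR0 : (0 : ℝ) < R := by linarith
  have hlog0 : 0 ≤ Real.log R := Real.log_nonneg hR1
  have hlogR : Real.log R ≤ R := by linarith [Real.log_le_sub_one_of_pos hR0]
  -- `log c ≤ |κ| R⁴`
  have hc4 : Real.log c ≤ |κ| * R ^ (4 : ℕ) := by
    have hA : 0 ≤ R ^ (1 / 3 : ℝ) * Real.log R ^ 3 := by positivity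
    calc Real.log c ≤ κ * R ^ (1 / 3 : ℝ) * Real.log R ^ 3 := h1
      _ ≤ |κ| * (R ^ (1 / 3 : ℝ) * Real.log R ^ 3) := by
          rw [mul_assoc]; exact mul_le_mul_of_nonneg_right (le_abs_self κ) hA
      _ ≤ |κ| * (R ^ (1 : ℝ) * R ^ 3) := by
          apply mul_le_mul_of_nonneg_left _ (abs_nonneg κ)
          exact mul_le_mul (Real.rpow_le_rpow_of_exponent_le hR1 (by norm_num))
            (pow_le_pow_left₀ hlog0 hlogR 3) (by positivity) (by positivity)
      _ = |κ| * R ^ (4 : ℕ) := by rw [Real.rpow_one]; ring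
  -- `max{e, 2 log c} ≤ (2|κ|+3) R⁴`
  have hR4 : (1 : ℝ) ≤ R ^ (4 : ℕ) := one_le_pow₀ hR1
  have hM : Real.exp 1 ≤ (2 * |κ| + 3) * R ^ (4 : ℕ) := by
    have he : Real.exp 1 ≤ 3 := by have := Real.exp_one_lt_d9; linarith
    calc Real.exp 1 ≤ 3 := he
      _ ≤ (2 * |κ| + 3) * 1 := by linarith [abs_nonneg κ]
      _ ≤ (2 * |κ| + 3) * R ^ (4 : ℕ) := mul_le_mul_of_nonneg_left hR4 (by linarith [abs_nonneg κ])
  have ht2 : 2 * Real.log c ≤ (2 * |κ| + 3) * R ^ (4 : ℕ) := by nlinarith [abs_nonneg κ]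
  have hY : Real.log (max (Real.exp 1) (2 * Real.log c)) ≤ Real.log (2 * |κ| + 3) + 4 * Real.log R := by
    calc Real.log (max (Real.exp 1) (2 * Real.log c)) ≤ Real.log ((2 * |κ| + 3) * R ^ (4 : ℕ)) :=
          log_max_exp_le hM ht2
      _ = Real.log (2 * |κ| + 3) + 4 * Real.log R := by
          rw [Real.log_mul (by linarith [abs_nonneg κ]) (by positivity), Real.log_pow]; push_cast; ring
  -- `log R ≤ (2/η) R^η` (from `log R ≤ R^{η}/η`... with room) and `1 ≤ R^η`
  have hRη : (1 : ℝ) ≤ R ^ η := Real.one_le_rpow hR1 hη.le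
  have hlogRη : Real.log R ≤ R ^ η / η := Real.log_le_rpow_div hR0.le hη
  have h8 : 4 * Real.log R ≤ (8 / η) * R ^ η := by
    have : 4 * (R ^ η / η) = (4 / η) * R ^ η := by ring
    have h48 : (4 / η) * R ^ η ≤ (8 / η) * R ^ η :=
      mul_le_mul_of_nonneg_right (by gcongr; norm_num) (by linarith)
    linarith [mul_le_mul_of_nonneg_left hlogRη (by norm_num : (0 : ℝ) ≤ 4)]
  calc Real.log (max (Real.exp 1) (2 * Real.log c)) ≤ Real.log (2 * |κ| + 3) + 4 * Real.log R := hY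
    _ ≤ Real.log (2 * |κ| + 3) * R ^ η + (8 / η) * R ^ η :=
        add_le_add (le_mul_of_one_le_right hlk hRη) h8
    _ = (Real.log (2 * |κ| + 3) + 8 / η) * R ^ η := by ring

/-! ### The single-place bound -/

/-- At a prime `p ∣ a` of an abc triple, `ν_p(abc) = ν_p(a)` (`p ∤ b`, `p ∤ c` by coprimality). [folklore] -/
theorem factorization_abc_eq_of_dvd_a {a b c p : ℕ} (h : IsABCTriple a b c) (hp : p.Prime) (hpa : p ∣ a) :
    (a * b * c).factorization p = a.factorization p := by
  obtain ⟨ha, hb, habc, hcop⟩ := h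
  have hc : 0 < c := by omega
  have hpb : ¬p ∣ b := fun hpb => hp.one_lt.ne' (Nat.dvd_one.mp (hcop.gcd_eq_one ▸ Nat.dvd_gcd hpa hpb))
  have hpc : ¬p ∣ c := fun hpc => hpb (by
    have : p ∣ c - a := Nat.dvd_sub hpc hpa
    rwa [show c - a = b by omega] at this)
  rw [Nat.factorization_mul (by positivity) hc.ne', Nat.factorization_mul ha.ne' hb.ne']
  simp [Nat.factorization_eq_zero_of_not_dvd hpb, Nat.factorization_eq_zero_of_not_dvd hpc]

/-- At a prime `p ∣ c` of an abc triple, `ν_p(abc) = ν_p(c)`. [folklore] -/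
theorem factorization_abc_eq_of_dvd_c {a b c p : ℕ} (h : IsABCTriple a b c) (hp : p.Prime) (hpc : p ∣ c) :
    (a * b * c).factorization p = c.factorization p := by
  obtain ⟨ha, hb, habc, hcop⟩ := h
  have hc : 0 < c := by omega
  have hac : a.Coprime c := coprime_left_of_isABCTriple ⟨ha, hb, habc, hcop⟩
  have hbc : b.Coprime c := coprime_right_of_isABCTriple ⟨ha, hb, habc, hcop⟩
  have hpa : ¬p ∣ a := fun hpa => hp.one_lt.ne' (Nat.dvd_one.mp (hac.gcd_eq_one ▸ Nat.dvd_gcd hpa hpc))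
  have hpb : ¬p ∣ b := fun hpb => hp.one_lt.ne' (Nat.dvd_one.mp (hbc.gcd_eq_one ▸ Nat.dvd_gcd hpb hpc))
  rw [Nat.factorization_mul (by positivity) hc.ne', Nat.factorization_mul ha.ne' hb.ne']
  simp [Nat.factorization_eq_zero_of_not_dvd hpa, Nat.factorization_eq_zero_of_not_dvd hpb]

/-- **The single-place bound of the Baker method** (conditional on Pasten's approximation bound
`PastenApproximationBound K`, `K ≥ 1` — Matveev + Yu 2007 over `ℚ`). For every `η > 0` there is `C > 0` such
that for every abc triple `a + b = c` and every prime `p ∣ abc`,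

  `ν_p(abc) · log p ≤ C · p · rad(abc)^η`.

Proof: at `p ∣ a` (resp. `b`, by symmetry; resp. `c`, for `ab > 1`), Pasten's `p`-adic clause
(`padic_bound_a` / `padic_bound_c` at threshold `N = 0`) gives `ν_p log p < Θ · (p/log p)(log p + Y) ≤ 3 Θ p Y`
(`div_log_mul_add_le`), with `Θ ≤ K C₁ R^{η/2}` (`theta_zero_le_mul_rpow`) and `Y ≤ C₂ R^{η/2}`
(`log_max_two_mul_log_le_mul_rpow`, through Stewart–Yu `bakerShapeBound_third_three_of_approximationBound`);
the triple `1 + 1 = 2` is checked by hand. This is the per-prime step of Stewart–Yu's proof read as a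
statement: a single tower costs a factor `p`, everything else is `R^{o(1)}`.
[cite: StewartYu2001, Theorem 1 (proof: the p-adic orders at the primes of a, b, c)] -/
theorem exists_single_place_bound_of_approximationBound {K : ℝ} (hK : 1 ≤ K)
    (hP : PastenApproximationBound K) {η : ℝ} (hη : 0 < η) :
    ∃ C : ℝ, 0 < C ∧ ∀ a b c : ℕ, IsABCTriple a b c → ∀ p : ℕ, p.Prime → p ∣ a * b * c →
      ((a * b * c).factorization p : ℝ) * Real.log p ≤ C * p * (rad a b c : ℝ) ^ η := by
  have hK0 : 0 ≤ K := zero_le_one.trans hK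
  have hη2 : 0 < η / 2 := half_pos hη
  obtain ⟨C₁, hC₁1, hC₁⟩ := exists_prod_mul_log_div_rpow_le hK0 hη2
  obtain ⟨C₂, hC₂1, hC₂⟩ :=
    log_max_two_mul_log_le_mul_rpow (bakerShapeBound_third_three_of_approximationBound hK hP) hη2
  refine ⟨3 * K * C₁ * C₂ + 1, by positivity, fun a b c ht p hp hpabc => ?_⟩
  obtain ⟨ha, hb, habc, hcop⟩ := id ht
  have hc : 0 < c := by omega
  have h0 : a * b * c ≠ 0 := by positivity
  have hR2 : (2 : ℝ) ≤ (rad a b c : ℝ) := by exact_mod_cast IsABCTriple.two_le_rad ht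
  set R : ℝ := (rad a b c : ℝ) with hRdef
  have hR1 : (1 : ℝ) ≤ R := by linarith
  have hRη2 : (0 : ℝ) ≤ R ^ (η / 2) := Real.rpow_nonneg (by linarith) _
  have hRη : (1 : ℝ) ≤ R ^ η := Real.one_le_rpow hR1 hη.le
  have hRsplit : R ^ (η / 2) * R ^ (η / 2) = R ^ η := by
    rw [← Real.rpow_add (by linarith)]; ring_nf
  have hp2 : (2 : ℝ) ≤ p := by exact_mod_cast hp.two_le
  have hp0 : (0 : ℝ) ≤ p := by linarith
  set Y : ℝ := Real.log (max (Real.exp 1) (2 * Real.log c)) with hYdef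
  have hY1 : 1 ≤ Y := one_le_log_max_exp _
  have hY := hC₂ a b c ht
  have hnum : (p : ℝ) / Real.log p * (Real.log p + Y) ≤ 3 * p * Y := div_log_mul_add_le hp2 hY1
  -- the generic step: from a place bound with `Θ ≤ K C₁ R^{η/2}` to the claim
  have step : ∀ {Θ ν : ℝ}, 0 ≤ Θ → Θ ≤ K * C₁ * R ^ (η / 2) →
      ν * Real.log p < Θ * ((p : ℝ) / Real.log p * (Real.log p + Y)) →
      ν * Real.log p ≤ (3 * K * C₁ * C₂ + 1) * p * R ^ η := by
    intro Θ ν hΘ0 hΘ hlt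
    have h1 : Θ * ((p : ℝ) / Real.log p * (Real.log p + Y)) ≤ Θ * (3 * p * Y) :=
      mul_le_mul_of_nonneg_left hnum hΘ0
    have h2 : Θ * (3 * p * Y) ≤ (K * C₁ * R ^ (η / 2)) * (3 * p * (C₂ * R ^ (η / 2))) :=
      mul_le_mul hΘ (by nlinarith [hY, hp0]) (by positivity) (by positivity)
    have h3 : (K * C₁ * R ^ (η / 2)) * (3 * p * (C₂ * R ^ (η / 2))) = 3 * K * C₁ * C₂ * p * R ^ η := by
      rw [← hRsplit]; ring
    have h4 : 3 * K * C₁ * C₂ * p * R ^ η ≤ (3 * K * C₁ * C₂ + 1) * p * R ^ η := by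
      have : 0 ≤ (p : ℝ) * R ^ η := by positivity
      nlinarith
    linarith
  -- which member does `p` divide?
  rcases (Nat.Prime.dvd_mul hp).mp hpabc with hpab | hpc
  · rcases (Nat.Prime.dvd_mul hp).mp hpab with hpa | hpb
    · -- `p ∣ a`
      rw [factorization_abc_eq_of_dvd_a ht hp hpa]
      have hΘ := theta_zero_le_mul_rpow hK hη2.le hC₁ hb.ne' hc.ne' (coprime_right_of_isABCTriple ht)
        ⟨a, by ring⟩ h0
      exact step (theta_nonneg hK0 b c 0) hΘ (padic_bound_a hK hP ht 0 hp hpa)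
    · -- `p ∣ b`: the swapped triple `(b, a, c)`
      rw [show a * b * c = b * a * c by ring, factorization_abc_eq_of_dvd_a ht.swap hp hpb]
      have hΘ := theta_zero_le_mul_rpow hK hη2.le hC₁ ha.ne' hc.ne' (coprime_left_of_isABCTriple ht)
        ⟨b, by ring⟩ h0
      exact step (theta_nonneg hK0 a c 0) hΘ (padic_bound_a hK hP ht.swap 0 hp hpb)
  · -- `p ∣ c`
    rw [factorization_abc_eq_of_dvd_c ht hp hpc]
    by_cases h1 : 1 < a * b
    · have hΘ := theta_zero_le_mul_rpow hK hη2.le hC₁ ha.ne' hb.ne' hcop ⟨c, rfl⟩ h0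
      exact step (theta_nonneg hK0 a b 0) hΘ (padic_bound_c hK hP ht h1 0 hp hpc)
    · -- the triple `1 + 1 = 2`: `ν_2(2) log 2 = log 2 ≤ (…+1) · 2 · R^η`
      have hab : a * b = 1 := by have : 1 ≤ a * b := Nat.mul_pos ha hb; omega
      have ha1 : a = 1 := Nat.eq_one_of_mul_eq_one_right hab
      have hb1 : b = 1 := Nat.eq_one_of_mul_eq_one_left hab
      have hc2 : c = 2 := by omega
      subst hc2
      have hp2' : p = 2 := (Nat.prime_dvd_prime_iff_eq hp Nat.prime_two).mp hpc
      subst hp2'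
      have hf : (Nat.factorization 2) 2 = 1 := by
        rw [Nat.Prime.factorization_self Nat.prime_two]
      rw [hf]
      push_cast
      have hl2 : Real.log 2 ≤ 1 := by have := Real.log_two_lt_d9; linarith
      have hbig : (1 : ℝ) ≤ (3 * K * C₁ * C₂ + 1) * 2 * R ^ η := by
        have h6 : (1 : ℝ) ≤ 3 * K * C₁ * C₂ + 1 := by
          have : 0 ≤ 3 * K * C₁ * C₂ := by positivity
          linarith
        calc (1 : ℝ) = 1 * 1 * 1 := by ring
          _ ≤ (3 * K * C₁ * C₂ + 1) * 2 * R ^ η :=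
              mul_le_mul (mul_le_mul h6 (by norm_num) zero_le_one (by positivity)) hRη zero_le_one
                (by positivity)
      linarith

/-- **Below Stewart–Yu at the small primes.** For every `δ > 0` there is `C > 0` such that for every abc
triple and every prime `p ∣ abc` with `p ≤ rad(abc)^{1/3 − 2δ}`:

  `ν_p(abc) · log p ≤ C · rad(abc)^{1/3 − δ}`,

strictly below the scale `R^{1/3}(log R)³` of the Stewart–Yu bound for the whole `log c`
(`exists_single_place_bound_of_approximationBound` at `η = δ`). At a FIXED prime the same theorem gives
`ν_p(abc) log p ≪_{p,η} R^η`. Conditional on `PastenApproximationBound K`.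
[cite: StewartYu2001, Theorem 1 (proof: the p-adic orders at the primes of a, b, c)] -/
theorem exists_single_place_bound_below_stewartYu_of_approximationBound {K : ℝ} (hK : 1 ≤ K)
    (hP : PastenApproximationBound K) {δ : ℝ} (hδ : 0 < δ) :
    ∃ C : ℝ, 0 < C ∧ ∀ a b c : ℕ, IsABCTriple a b c → ∀ p : ℕ, p.Prime → p ∣ a * b * c →
      (p : ℝ) ≤ (rad a b c : ℝ) ^ ((1 : ℝ) / 3 - 2 * δ) →
      ((a * b * c).factorization p : ℝ) * Real.log p ≤ C * (rad a b c : ℝ) ^ ((1 : ℝ) / 3 - δ) := by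
  obtain ⟨C, hC0, hC⟩ := exists_single_place_bound_of_approximationBound hK hP hδ
  refine ⟨C, hC0, fun a b c ht p hp hpabc hple => ?_⟩
  have h := hC a b c ht p hp hpabc
  have hR1 : (1 : ℝ) ≤ (rad a b c : ℝ) := by
    exact_mod_cast (show 1 ≤ rad a b c from le_trans one_le_two (IsABCTriple.two_le_rad ht))
  have hR0 : (0 : ℝ) < (rad a b c : ℝ) := by linarith
  have hRδ : 0 ≤ (rad a b c : ℝ) ^ δ := Real.rpow_nonneg hR0.le _
  calc ((a * b * c).factorization p : ℝ) * Real.log p ≤ C * p * (rad a b c : ℝ) ^ δ := h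
    _ ≤ C * (rad a b c : ℝ) ^ ((1 : ℝ) / 3 - 2 * δ) * (rad a b c : ℝ) ^ δ :=
        mul_le_mul_of_nonneg_right (mul_le_mul_of_nonneg_left hple hC0.le) hRδ
    _ = C * (rad a b c : ℝ) ^ ((1 : ℝ) / 3 - δ) := by
        rw [mul_assoc, ← Real.rpow_add hR0]; ring_nf

end Summit.ABC.ABC.Theorems.SingleTowerSzpiroLine

end
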